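import Mathlib
import Summits.Langlands.Langlands.Theorems.SoloInformedWLineAOneTwo

/-!
# Solo (informed) rung s28/7: degree bookkeeping of the W-mode (rigid W-lines with `a₁ = 2`)

Setting (paper §16.13(j″), corollary (iii); claims c301/c302/c305/c308; manual `work/s28/HOWTO.md` §9).
In the graded `ℤ₇[X]/(X⁷+7X)`-presentation of the genus module of the W-line, the strand generated in
degree `t` with length `n` occupies the degrees `(t + i) mod 6`, `i < n`; a RIGID W-field
(`Cl(F_W)[7] = 0`) has nothing in degree `0`, and a gluing into `V₁ = j(C₁)` needs the strand end
`X^{n} ẽ_t` to sit in degree `1`, i.e. `t + n ≡ 1 (mod 6)`.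

* `soloInformed_rigid_strand5` / `soloInformed_rigid_strand3`: avoiding degree `0` forces `n₅ = 1` and
  `n₃ ≤ 3` (lengths `≤ 6`);
* `soloInformed_v1_glue_degrees`: for `t ∈ {3,5}` and `1 ≤ n ≤ 6`, `t + n ≡ 1 (mod 6)` iff
  `(t,n) ∈ {(3,4), (5,2)}` — so at a rigid field no strand reaches `V₁`, and `|j(C₁)| = 49`
  (which needs such a gluing, c308) is impossible: P55b;
* `soloInformed_wline_a1two_reading_third`: the third rigid option `n = (1,3,1)` has the P54 profile
  `(2,5,6,9,10,10,12)` (not observed in the census), whose readings are exactly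
  `{(1,3,1,0), (1,3,2,1), (1,4,1,1)}` — unique given `ν_W = 0`;
* `soloInformed_rigid_a1two_profiles_distinct`: the three rigid profiles (`n₃ = 1, 2, 3`) are pairwise
  distinct, so at a rigid `a = (2,1,1)` field the census vector determines the structure (the W-mode
  engine emulation `w1_fitW.py` finds exactly these three structures, c308).
-/

namespace Summit.Langlands.Langlands.Theorems

open Finset

/-- A 5-strand of length `n ≤ 6` avoids degree `0` iff `n = 1`. -/
theorem soloInformed_rigid_strand5 :
    ∀ n ∈ Icc 1 6, ((∀ i < n, (5 + i) % 6 ≠ 0) ↔ n = 1) := by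
  decide

/-- A 3-strand of length `n ≤ 6` avoids degree `0` iff `n ≤ 3`. -/
theorem soloInformed_rigid_strand3 :
    ∀ n ∈ Icc 1 6, ((∀ i < n, (3 + i) % 6 ≠ 0) ↔ n ≤ 3) := by
  decide

/-- A strand from degree `t ∈ {3,5}` of length `1 ≤ n ≤ 6` ends in degree `1` (the only way to glue into
`V₁ = j(C₁)`) iff `(t, n) ∈ {(3,4), (5,2)}`; both pass through degree `0`. -/
theorem soloInformed_v1_glue_degrees :
    ∀ t ∈ ({3, 5} : Finset ℕ), ∀ n ∈ Icc 1 6,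
      ((t + n) % 6 = 1 ↔ (t, n) ∈ ({(3, 4), (5, 2)} : Finset (ℕ × ℕ))) := by
  decide

/-- Consequence: the two `V₁`-gluing strands meet degree `0` (`i = 3`, resp. `i = 1`). -/
theorem soloInformed_v1_glue_meets_degree_zero :
    (3 + 3) % 6 = 0 ∧ 3 < 4 ∧ (5 + 1) % 6 = 0 ∧ 1 < 2 := by
  decide

/-- The P54 profile of the third rigid structure `n = (1,3,1)`, `ν_W = 0`. -/
def soloInformedWVectorC (k : ℕ) : ℕ :=
  if k = 0 then 2 else if k = 1 then 5 else if k = 2 then 6 else if k = 3 then 9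
  else if k = 4 then 10 else if k = 5 then 10 else 12

/-- The vector `(2,5,6,9,10,10,12)` has exactly the P54 readings
`(ℓ₁,ℓ₃,ℓ₅,ν_W) ∈ {(1,3,1,0), (1,3,2,1), (1,4,1,1)}`; with `ν_W = 0` the reading `(1,3,1)` is unique. -/
theorem soloInformed_wline_a1two_reading_third :
    ∀ ℓ₁ ∈ Icc 1 7, ∀ ℓ₃ ∈ Icc 1 7, ∀ ℓ₅ ∈ Icc 1 7, ∀ ν ≤ 1,
      (∀ k ≤ 6, soloInformedWProfileA1Two ℓ₁ ℓ₃ ℓ₅ ν k = soloInformedWVectorC k)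
        ↔ (ℓ₁, ℓ₃, ℓ₅, ν) ∈ ({(1, 3, 1, 0), (1, 3, 2, 1), (1, 4, 1, 1)} : Finset (ℕ × ℕ × ℕ × ℕ)) := by
  decide

/-- The three rigid `a = (2,1,1)` W-profiles (`n₃ = 1, 2, 3`) are pairwise distinct (they differ at
`k = 3, 4`), so the census vector determines the structure at a rigid `a₁ = 2` field. -/
theorem soloInformed_rigid_a1two_profiles_distinct :
    soloInformedWVectorA 3 ≠ soloInformedWVectorB 3 ∧ soloInformedWVectorA 3 ≠ soloInformedWVectorC 3
      ∧ soloInformedWVectorB 4 ≠ soloInformedWVectorC 4 := by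
  decide

/-- The rigid readings are the P54 readings with `ℓ₁ = 1`, `ℓ₅ = 1`, `ν_W = 0`, `ℓ₃ ≤ 3`:
their profiles are `A`, `B`, `C` for `ℓ₃ = 1, 2, 3`. -/
theorem soloInformed_rigid_a1two_profile_table :
    (∀ k ≤ 6, soloInformedWProfileA1Two 1 1 1 0 k = soloInformedWVectorA k)
      ∧ (∀ k ≤ 6, soloInformedWProfileA1Two 1 2 1 0 k = soloInformedWVectorB k)
      ∧ (∀ k ≤ 6, soloInformedWProfileA1Two 1 3 1 0 k = soloInformedWVectorC k) := by
  decide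

end Summit.Langlands.Langlands.Theorems
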